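import Summits.MatrixMultiplication.MatrixMultiplication.Theses.StabilizerTensorRank

/-!
# Crux `OmegaStabTwo` (stmt-MatrixMultiplication-3827) — line `defect-contraction` (crux-strategist skeleton)

SKELETON LINE = the typed decomposition of the deciding crux:

  `stub_seed : StabBeatsStrassen` (route item stmt-MatrixMultiplication-3828: some scale beats the Strassen
  frame 7^k inside the stabilizer model) and
  `stub_contraction : StabDefectContraction` (route item stmt-MatrixMultiplication-17943, crux rank 3 — uniform self-improvement below the Strassen frame: a rate
  `c > 0` such that every sub-Strassen stabilizer scheme `(k, r)`, defect `D = r/4^k`, improves at some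
  Kronecker-multiple scale `m·k` to `r' ≤ r^m / D^(c·m)` terms — Coppersmith–Winograd 1982 made uniform and
  kept inside the model),

composed by the KERNEL-CHECKED `OmegaStabTwo_of : OmegaStabTwo` (modulo the two stubs; the binder form
`omegaStabTwo_glue : StabBeatsStrassen → StabDefectContraction → OmegaStabTwo` is sorry-free) (iteration from the seed; the normalised log-defect `e = log(r/4^k)/k` contracts,
`e' ≤ (1 - c) e`; `e ≤ ε log 2` is `r ≤ 2^((2+ε)k)`). Sorries ONLY in the two stubs. The same glue,
Theorems-ready (no stubs), is attached as evidence `split.lean` on stmt-MatrixMultiplication-3827 for a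
prover to land as `Theorems/StabilizerTensorRankOmegaStabTwoSplit.lean`.

Honours: no Disproof.lean exists for this crux (nothing to cite); negatives index (7 entries, none on
stabilizer schemes) untouched. Probes `stub → OmegaStabTwo`, `stub → MatrixMultiplication` by
`first | exact? | simpa | aesop` fail for both stubs (folder bc/*_probe.lean, rc 1 each).
-/

set_option linter.dupNamespace false

noncomputable section

open scoped BigOperators

namespace Summit.MatrixMultiplication.MatrixMultiplication.Cruxes.OmegaStabTwo.DefectContraction

open Literature.Computability.AlgebraicComplexity Literature.Computability.QuantumComplexity
open Summit.MatrixMultiplication.MatrixMultiplication.Theses.StabilizerTensorRank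

/-! ## Flattening: a stabilizer scheme of `⟨2^k⟩` has at least `4^k` terms -/

/-- `4^k = (2^k)² ≤ R(⟨2^k⟩) ≤ χ₃(⟨2^k⟩) ≤ r` for every stabilizer scheme with `r` terms.
[folklore] -/
theorem four_pow_le_of_hasStabilizerScheme {k r : ℕ} (h : HasStabilizerScheme k r) : 4 ^ k ≤ r := by
  have h1 := matMulTensor_sq_le_tensorRank ℂ (2 ^ k)
  have h2 := (tensorRank_le_stabTensorRank k).trans (stabTensorRank_le_of_hasStabilizerScheme h)
  have h3 : (2 ^ k) ^ 2 = 4 ^ k := by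
    rw [← pow_mul, mul_comm, pow_mul]
    norm_num
  calc 4 ^ k = (2 ^ k) ^ 2 := h3.symm
    _ ≤ _ := h1.trans h2

/-! ## One contraction step in logarithmic form -/

/-- If `r' · D^(c·m) ≤ r^m` with `D = r / 4^k ≥ 1`, `c ≤ 1`, then the normalised log-defect
contracts: `log (r' / 4^(mk)) / (mk) ≤ (1 - c) · log (r / 4^k) / k`. [folklore] -/
theorem defect_log_contraction {k m r r' : ℕ} {c : ℝ} (hk : 1 ≤ k) (hm : 1 ≤ m)
    (h4 : 4 ^ k ≤ r) (hr' : 1 ≤ r')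
    (hineq : (r' : ℝ) * ((r : ℝ) / 4 ^ k) ^ (c * m) ≤ (r : ℝ) ^ m) :
    Real.log ((r' : ℝ) / 4 ^ (m * k)) / ((m * k : ℕ) : ℝ) ≤
      (1 - c) * (Real.log ((r : ℝ) / 4 ^ k) / (k : ℝ)) := by
  have hkpos : (0 : ℝ) < k := by exact_mod_cast hk
  have hmpos : (0 : ℝ) < m := by exact_mod_cast hm
  have h4pos : (0 : ℝ) < (4 : ℝ) ^ k := by positivity
  have h4r : (4 : ℝ) ^ k ≤ r := by exact_mod_cast h4
  have hrpos : (0 : ℝ) < r := h4pos.trans_le h4r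
  have hr'pos : (0 : ℝ) < r' := by exact_mod_cast hr'
  set D : ℝ := (r : ℝ) / 4 ^ k with hD_def
  have hD1 : 1 ≤ D := by
    rw [hD_def, le_div_iff₀ h4pos, one_mul]
    exact h4r
  have hDpos : 0 < D := one_pos.trans_le hD1
  have hlogD : Real.log D = Real.log r - k * Real.log 4 := by
    rw [hD_def, Real.log_div hrpos.ne' h4pos.ne', Real.log_pow]
  -- logarithm of the hypothesis: `log r' + c m log D ≤ m log r`
  have hlog : Real.log r' + c * m * Real.log D ≤ m * Real.log r := by
    have h := Real.log_le_log (by positivity) hineq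
    rw [Real.log_mul hr'pos.ne' (Real.rpow_pos_of_pos hDpos _).ne', Real.log_rpow hDpos,
      Real.log_pow] at h
    linarith
  -- hence `log r' - m k log 4 ≤ m (1 - c) log D`
  have hkey : Real.log r' - (m : ℝ) * k * Real.log 4 ≤ (m : ℝ) * (1 - c) * Real.log D := by
    have hr_eq : Real.log (r : ℝ) = Real.log D + k * Real.log 4 := by linarith [hlogD]
    rw [hr_eq] at hlog
    have : (m : ℝ) * (Real.log D + k * Real.log 4)
        = (m : ℝ) * Real.log D + (m : ℝ) * k * Real.log 4 := by ring
    rw [this] at hlog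
    have : c * m * Real.log D = (m : ℝ) * c * Real.log D := by ring
    rw [this] at hlog
    have : (m : ℝ) * (1 - c) * Real.log D = (m : ℝ) * Real.log D - (m : ℝ) * c * Real.log D := by
      ring
    rw [this]
    linarith
  -- divide by `m k > 0`
  have hmk : ((m * k : ℕ) : ℝ) = (m : ℝ) * k := by push_cast; ring
  have hmkpos : (0 : ℝ) < (m : ℝ) * k := mul_pos hmpos hkpos
  have hlog' : Real.log ((r' : ℝ) / 4 ^ (m * k)) = Real.log r' - (m : ℝ) * k * Real.log 4 := by
    rw [Real.log_div hr'pos.ne' (by positivity), Real.log_pow]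
    push_cast
    ring
  rw [hlog', hmk, div_le_iff₀ hmkpos]
  calc Real.log r' - (m : ℝ) * k * Real.log 4
      ≤ (m : ℝ) * (1 - c) * Real.log D := hkey
    _ = (1 - c) * (Real.log D / k) * ((m : ℝ) * k) := by
        field_simp

/-! ## From a small log-defect to the `2^((2+ε)k)` bound -/

/-- `log (r / 4^k) / k ≤ ε log 2` is `r ≤ 2^((2+ε)k)` (for `r ≥ 4^k`, `k ≥ 1`). [folklore] -/
theorem le_two_rpow_of_log_defect {k r : ℕ} {ε : ℝ} (hk : 1 ≤ k) (h4 : 4 ^ k ≤ r)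
    (h : Real.log ((r : ℝ) / 4 ^ k) / (k : ℝ) ≤ ε * Real.log 2) :
    (r : ℝ) ≤ (2 : ℝ) ^ ((2 + ε) * k) := by
  have hkpos : (0 : ℝ) < k := by exact_mod_cast hk
  have h4pos : (0 : ℝ) < (4 : ℝ) ^ k := by positivity
  have h4r : (4 : ℝ) ^ k ≤ r := by exact_mod_cast h4
  have hrpos : (0 : ℝ) < r := h4pos.trans_le h4r
  have hlog4 : Real.log 4 = 2 * Real.log 2 := by
    rw [show (4 : ℝ) = 2 ^ 2 by norm_num, Real.log_pow]
    norm_num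
  rw [div_le_iff₀ hkpos, Real.log_div hrpos.ne' h4pos.ne', Real.log_pow, hlog4] at h
  rw [Real.rpow_def_of_pos two_pos]
  calc (r : ℝ) = Real.exp (Real.log r) := (Real.exp_log hrpos).symm
    _ ≤ Real.exp (Real.log 2 * ((2 + ε) * k)) := by
        rw [Real.exp_le_exp]
        nlinarith [Real.log_pos one_lt_two]

/-! ## The glue: seed + uniform contraction ⇒ `ω_stab = 2` -/

/-- **Seed + uniform contraction ⇒ `ω_stab = 2` (in `HasStabilizerScheme` form).** A
sub-Strassen stabilizer scheme at some scale `k₀ ≥ 1` together with uniform defect contraction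
below the Strassen frame give, for every `ε > 0`, a scale `k ≥ 1` with a stabilizer scheme of at
most `2^((2+ε)k)` terms: iterate the contraction from the seed; the scale multiplies,
sub-Strassen-ness is preserved, and the normalised log-defect decays geometrically to `0`.
[folklore] -/
theorem stabExponentTwo_of_seed_of_defectContraction
    (hQ : ∃ k r : ℕ, 1 ≤ k ∧ r < 7 ^ k ∧ HasStabilizerScheme k r)
    (hP : ∃ c : ℝ, 0 < c ∧ ∀ k r : ℕ, 1 ≤ k → r < 7 ^ k → HasStabilizerScheme k r →
      ∃ m r' : ℕ, 1 ≤ m ∧ HasStabilizerScheme (m * k) r' ∧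
        (r' : ℝ) * ((r : ℝ) / 4 ^ k) ^ (c * m) ≤ (r : ℝ) ^ m) :
    ∀ ε : ℝ, 0 < ε → ∃ k : ℕ, 1 ≤ k ∧ ∃ r : ℕ, (r : ℝ) ≤ (2 : ℝ) ^ ((2 + ε) * k) ∧
      HasStabilizerScheme k r := by
  classical
  obtain ⟨c₀, hc₀, hstep₀⟩ := hP
  -- w.l.o.g. the rate is at most `1`
  set c : ℝ := min c₀ 1 with hc_def
  have hc : 0 < c := lt_min hc₀ one_pos
  have hc1 : c ≤ 1 := min_le_right _ _
  have hcc₀ : c ≤ c₀ := min_le_left _ _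
  have hstep : ∀ k r : ℕ, 1 ≤ k → r < 7 ^ k → HasStabilizerScheme k r →
      ∃ m r' : ℕ, 1 ≤ m ∧ HasStabilizerScheme (m * k) r' ∧
        (r' : ℝ) * ((r : ℝ) / 4 ^ k) ^ (c * m) ≤ (r : ℝ) ^ m := by
    intro k r hk hr hS
    obtain ⟨m, r', hm, hS', hineq⟩ := hstep₀ k r hk hr hS
    refine ⟨m, r', hm, hS', le_trans ?_ hineq⟩
    have h4pos : (0 : ℝ) < (4 : ℝ) ^ k := by positivity
    have hD : (1 : ℝ) ≤ (r : ℝ) / 4 ^ k := by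
      rw [le_div_iff₀ h4pos, one_mul]
      exact_mod_cast four_pow_le_of_hasStabilizerScheme hS
    have hexp : c * m ≤ c₀ * m := mul_le_mul_of_nonneg_right hcc₀ (Nat.cast_nonneg m)
    exact mul_le_mul_of_nonneg_left (Real.rpow_le_rpow_of_exponent_le hD hexp) (Nat.cast_nonneg _)
  -- choice functions for the step (junk outside the sub-Strassen regime)
  choose! fm fr hspec using hstep
  -- the iteration on (scale, size)
  let F : ℕ × ℕ → ℕ × ℕ := fun p => (fm p.1 p.2 * p.1, fr p.1 p.2)
  obtain ⟨k₀, r₀, hk₀, hr₀, hS₀⟩ := hQ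
  let sq : ℕ → ℕ × ℕ := fun j => F^[j] (k₀, r₀)
  -- normalised log-defect
  let e : ℕ × ℕ → ℝ := fun p => Real.log ((p.2 : ℝ) / 4 ^ p.1) / (p.1 : ℝ)
  -- invariant along the iteration
  have hinv : ∀ j, 1 ≤ (sq j).1 ∧ (sq j).2 < 7 ^ (sq j).1 ∧ HasStabilizerScheme (sq j).1 (sq j).2 ∧
      e (sq j) ≤ (1 - c) ^ j * e (k₀, r₀) := by
    intro j
    induction j with
    | zero =>
        refine ⟨hk₀, hr₀, hS₀, ?_⟩
        simp [sq]
    | succ j ih =>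
        obtain ⟨hk, hr, hS, he⟩ := ih
        have hsq : sq (j + 1) = F (sq j) := by
          simp only [sq]
          rw [Function.iterate_succ_apply']
        obtain ⟨hm, hS', hineq⟩ := hspec (sq j).1 (sq j).2 hk hr hS
        have h4 : 4 ^ (sq j).1 ≤ (sq j).2 := four_pow_le_of_hasStabilizerScheme hS
        have h4' : 4 ^ (fm (sq j).1 (sq j).2 * (sq j).1) ≤ fr (sq j).1 (sq j).2 :=
          four_pow_le_of_hasStabilizerScheme hS'
        have hr'1 : 1 ≤ fr (sq j).1 (sq j).2 := le_trans (Nat.one_le_pow _ _ (by norm_num)) h4'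
        -- the new size is below the Strassen frame: r' ≤ r^m < 7^(mk)
        have hD : (1 : ℝ) ≤ ((sq j).2 : ℝ) / 4 ^ (sq j).1 := by
          rw [le_div_iff₀ (by positivity), one_mul]
          exact_mod_cast h4
        have hr'le : fr (sq j).1 (sq j).2 ≤ (sq j).2 ^ fm (sq j).1 (sq j).2 := by
          have h1 : (1 : ℝ) ≤ (((sq j).2 : ℝ) / 4 ^ (sq j).1) ^ (c * fm (sq j).1 (sq j).2) :=
            Real.one_le_rpow hD (by positivity)
          have h2 : (fr (sq j).1 (sq j).2 : ℝ) ≤ ((sq j).2 : ℝ) ^ fm (sq j).1 (sq j).2 := by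
            calc (fr (sq j).1 (sq j).2 : ℝ)
                = (fr (sq j).1 (sq j).2 : ℝ) * 1 := (mul_one _).symm
              _ ≤ (fr (sq j).1 (sq j).2 : ℝ) *
                    (((sq j).2 : ℝ) / 4 ^ (sq j).1) ^ (c * fm (sq j).1 (sq j).2) :=
                  mul_le_mul_of_nonneg_left h1 (Nat.cast_nonneg _)
              _ ≤ _ := hineq
          exact_mod_cast h2
        have hr'lt : fr (sq j).1 (sq j).2 < 7 ^ (fm (sq j).1 (sq j).2 * (sq j).1) := by
          calc fr (sq j).1 (sq j).2 ≤ (sq j).2 ^ fm (sq j).1 (sq j).2 := hr'le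
            _ < (7 ^ (sq j).1) ^ fm (sq j).1 (sq j).2 :=
                Nat.pow_lt_pow_left hr (Nat.pos_iff_ne_zero.mp hm)
            _ = 7 ^ (fm (sq j).1 (sq j).2 * (sq j).1) := by rw [← pow_mul, mul_comm]
        refine ⟨?_, ?_, ?_, ?_⟩
        · rw [hsq]; exact Nat.mul_pos hm hk
        · rw [hsq]; exact hr'lt
        · rw [hsq]; exact hS'
        · rw [hsq]
          have hcontr := defect_log_contraction (c := c) hk hm h4 hr'1 hineq
          calc e (F (sq j)) ≤ (1 - c) * e (sq j) := hcontr
            _ ≤ (1 - c) * ((1 - c) ^ j * e (k₀, r₀)) :=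
                mul_le_mul_of_nonneg_left he (by linarith)
            _ = (1 - c) ^ (j + 1) * e (k₀, r₀) := by ring
  -- the target: for every ε pick an iterate with log-defect ≤ ε log 2
  intro ε hε
  have he₀ : 0 ≤ e (k₀, r₀) := by
    have h4 : 4 ^ k₀ ≤ r₀ := four_pow_le_of_hasStabilizerScheme hS₀
    have h4pos : (0 : ℝ) < (4 : ℝ) ^ k₀ := by positivity
    have hD : (1 : ℝ) ≤ (r₀ : ℝ) / 4 ^ k₀ := by
      rw [le_div_iff₀ h4pos, one_mul]
      exact_mod_cast h4
    exact div_nonneg (Real.log_nonneg hD) (Nat.cast_nonneg _)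
  have hlog2 : 0 < Real.log 2 := Real.log_pos one_lt_two
  have hx : 0 < ε * Real.log 2 / (e (k₀, r₀) + 1) := by positivity
  obtain ⟨n, hn⟩ := exists_pow_lt_of_lt_one hx (by linarith : 1 - c < 1)
  obtain ⟨hk, -, hS, he⟩ := hinv n
  have hsmall : e (sq n) ≤ ε * Real.log 2 := by
    have h1 : (1 - c) ^ n * (e (k₀, r₀) + 1) < ε * Real.log 2 := by
      rwa [lt_div_iff₀ (by linarith)] at hn
    have h2 : (1 - c) ^ n * e (k₀, r₀) ≤ (1 - c) ^ n * (e (k₀, r₀) + 1) :=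
      mul_le_mul_of_nonneg_left (by linarith) (pow_nonneg (by linarith) n)
    linarith
  refine ⟨(sq n).1, hk, (sq n).2, ?_, hS⟩
  exact le_two_rpow_of_log_defect hk (four_pow_le_of_hasStabilizerScheme hS) hsmall

/-! ## The two registered stubs (the leaves of the decomposition) -/

/-- STUB (seed; = route item `StabBeatsStrassen`, stmt-MatrixMultiplication-3828): some scale beats the
Strassen frame inside the stabilizer model. Size L (finite search at k = 2, 3). -/
theorem stub_seed : StabBeatsStrassen := by
  sorry

/-- STUB (step; the new leaf `StabDefectContraction`): uniform self-improvement below the Strassen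
frame — rate `c > 0`, every sub-Strassen stabilizer scheme `(k, r)` improves at some scale `m·k` to
`r' · (r/4^k)^(c·m) ≤ r^m` terms. Size XL (open; a stabilizer laser/τ-step is the natural attack). -/
theorem stub_contraction : StabDefectContraction := by
  sorry

/-! ## Composition: the crux BY NAME, kernel-checked modulo `stub_seed`, `stub_contraction` -/

/-- **The crux `OmegaStabTwo` from the line**: seed (stub 1) — its scale is `≥ 1` automatically,
since `r < 7^0 = 1` contradicts `4^0 ≤ r` — then the iteration/limit glue
`stabExponentTwo_of_seed_of_defectContraction` fed with the contraction (stub 2); inline blocks ↔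
`HasStabilizerScheme` by `Iff.rfl`. [folklore] -/
theorem OmegaStabTwo_of :
    Summit.MatrixMultiplication.MatrixMultiplication.Theses.StabilizerTensorRank.OmegaStabTwo := by
  -- stub 1: the seed
  have hQ : StabBeatsStrassen := stub_seed
  unfold StabBeatsStrassen at hQ
  obtain ⟨k₀, r₀, hr₀, hS₀⟩ := hQ
  have hS : HasStabilizerScheme k₀ r₀ := (hasStabilizerScheme_iff k₀ r₀).2 hS₀
  have hk₀ : 1 ≤ k₀ := by
    rcases Nat.eq_zero_or_pos k₀ with h | h
    · exfalso
      subst h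
      have h4 := four_pow_le_of_hasStabilizerScheme hS
      simp at h4 hr₀
      omega
    · exact h
  -- stub 2: the contraction, iterated by the proved glue
  unfold Summit.MatrixMultiplication.MatrixMultiplication.Theses.StabilizerTensorRank.OmegaStabTwo
  intro ε hε
  obtain ⟨k, hk, r, hr, hSk⟩ :=
    stabExponentTwo_of_seed_of_defectContraction ⟨k₀, r₀, hk₀, hr₀, hS⟩
      (by have h := stub_contraction; unfold StabDefectContraction at h; exact h) ε hε
  exact ⟨k, hk, r, hr, (hasStabilizerScheme_iff k r).1 hSk⟩

/-- The same composition with the two leaves as HYPOTHESES (the glue item `OmegaStabTwoGlue :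
StabBeatsStrassen → StabDefectContraction → OmegaStabTwo` of the split, sorry-free; Theorems-ready
copy: evidence `split.lean`, decl `omegaStabTwo_of_stabBeatsStrassen_of_defectContraction`).
[folklore] -/
theorem omegaStabTwo_glue
    (hQ : StabBeatsStrassen) (hP : StabDefectContraction) :
    Summit.MatrixMultiplication.MatrixMultiplication.Theses.StabilizerTensorRank.OmegaStabTwo := by
  unfold StabDefectContraction at hP
  unfold StabBeatsStrassen at hQ
  obtain ⟨k₀, r₀, hr₀, hS₀⟩ := hQ
  have hS : HasStabilizerScheme k₀ r₀ := (hasStabilizerScheme_iff k₀ r₀).2 hS₀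
  have hk₀ : 1 ≤ k₀ := by
    rcases Nat.eq_zero_or_pos k₀ with h | h
    · exfalso
      subst h
      have h4 := four_pow_le_of_hasStabilizerScheme hS
      simp at h4 hr₀
      omega
    · exact h
  unfold Summit.MatrixMultiplication.MatrixMultiplication.Theses.StabilizerTensorRank.OmegaStabTwo
  intro ε hε
  obtain ⟨k, hk, r, hr, hSk⟩ :=
    stabExponentTwo_of_seed_of_defectContraction ⟨k₀, r₀, hk₀, hr₀, hS⟩ hP ε hε
  exact ⟨k, hk, r, hr, (hasStabilizerScheme_iff k r).1 hSk⟩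

end Summit.MatrixMultiplication.MatrixMultiplication.Cruxes.OmegaStabTwo.DefectContraction

end
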